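import Literature.Topology.FourManifolds.TracePermutationExtension
import Literature.Topology.FourManifolds.BasinEndgame
import Literature.Topology.FourManifolds.MilnorChartIndex
import HarnessLib

/-!
# Boundary diffeomorphisms permuting the co-core circles of a Morse handle structure extend
# (one gradient-like field; raw form)

Topic `Literature/Topology/FourManifolds` (support for the Torelli half of Griffiths' handlebody
theorem, `stmt-SmoothPoincare4-15190`; corollaries of `TracePermutationExtension.lean`).
Everything here is **proved**; the two definitions are bookkeeping.

* `BasinPair.diag B` — the diagonal pair of a basin setting (`ξ_A = ξ_B`);
  `BasinPair.SaddleData.withPerm` — saddle data with the correspondence of the saddles replaced by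
  any bijection matching the indices.
* `BasinSetting.diffeoExtends_of_traceOf_perm` — for a basin setting `B` on a compact `3`-manifold
  with boundary whose saddles have index `1` and a common value: **every diffeomorphism of `∂W`
  permuting the trace circles of the saddles (as sets) extends over `W`.**
* `Cobordism.IsMorseFunction.diffeoExtends_of_unstableSet_perm` — **raw form**: `W` compact of
  dimension `3`, `g` Morse on `(W; ∅, ∂W)` with a smooth gradient-like field `ξ`, a unique
  critical point `p₀` of index `0`, all other critical points of index `1` with one common value
  (e.g. the Morse data of a genus-`g` handlebody, `IsHandlebody`): every diffeomorphism `χ` of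
  `∂W` which, for a bijection `σ` of the saddles, carries the boundary points on trajectories from
  `s` onto those on trajectories from `σ s`, extends to a diffeomorphism of `W`.  In handle
  language: **a diffeomorphism of the boundary of a handlebody permuting the belt circles of the
  `1`-handles extends over the handlebody** (Griffiths (1964), §§3–6, with the standardisation
  near the belt circles done by isotopies).

What the Torelli criterion (T) of `HandlebodyKernelExtensionTorelli.lean` still needs after this
file is the Dehn/wave reduction of a based boundary diffeomorphism acting trivially on `π₁` to
one permuting the belt circles of SOME handle structure.

## References

* H. B. Griffiths, *Automorphisms of a 3-dimensional handlebody*, Abh. Math. Sem. Univ. Hamburg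
  26 (1964), §§3–6. [GriffithsHB1964Handlebody]
* J. Milnor, *Lectures on the h-cobordism theorem* (1965), Def. 3.1, Def. 3.9, Thm. 4.1.
  [MilnorHCobordism1965]
* M. W. Hirsch, *Differential Topology*, GTM 33 (1976), Ch. 8 §1 Thm. 1.3, §2, §3 Thm. 3.3.
  [HirschDT1976]
-/

open scoped Manifold ContDiff Topology
open Set Function Filter Metric

noncomputable section

namespace Literature.Topology.FourManifolds

open Cobordism FourManifolds.Flow

universe u

/-! ### Bookkeeping: the diagonal pair, permuting the correspondence -/

namespace BasinPair

variable {n : ℕ} {W : Type u} [TopologicalSpace W] [T2Space W] [SecondCountableTopology W]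
  [CompactSpace W] [ChartedSpace (EuclideanHalfSpace (n + 1)) W] [IsManifold (𝓡∂ (n + 1)) ∞ W]
  {g : W → ℝ} {ξ ξA ξB : Π x : W, TangentSpace (𝓡∂ (n + 1)) x}

/-- **The diagonal pair** of a basin setting: the same setting on both sides. [folklore] -/
def diag (B : BasinSetting g ξ) : BasinPair g ξ ξ where
  A := B
  B := B
  p₀_eq := rfl
  a'_eq := rfl
  φ_eq := rfl
  r₀_eq := rfl

/-- `diag_A`. [folklore] -/
@[simp] theorem diag_A (B : BasinSetting g ξ) : (diag B).A = B := rfl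
/-- `diag_B`. [folklore] -/
@[simp] theorem diag_B (B : BasinSetting g ξ) : (diag B).B = B := rfl

/-- **Saddle data with a new correspondence of the saddles** (any bijection matching the indices
of the boxes). [folklore] -/
def SaddleData.withPerm {P : BasinPair g ξA ξB} (Q : P.SaddleData) (σ' : SaddlePt n g ≃ SaddlePt n g)
    (hkk : ∀ s, (Q.DB (σ' s)).k = (Q.DA s).k) : P.SaddleData :=
  { Q with σ := σ', k_eq := hkk }

/-- `withPerm_DA`. [folklore] -/
@[simp] theorem SaddleData.withPerm_DA {P : BasinPair g ξA ξB} (Q : P.SaddleData) (σ' : SaddlePt n g ≃ SaddlePt n g)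
    (hkk : ∀ s, (Q.DB (σ' s)).k = (Q.DA s).k) : (Q.withPerm σ' hkk).DA = Q.DA := rfl
/-- `withPerm_σ`. [folklore] -/
@[simp] theorem SaddleData.withPerm_σ {P : BasinPair g ξA ξB} (Q : P.SaddleData) (σ' : SaddlePt n g ≃ SaddlePt n g)
    (hkk : ∀ s, (Q.DB (σ' s)).k = (Q.DA s).k) : (Q.withPerm σ' hkk).σ = σ' := rfl

end BasinPair

/-! ### The permutation theorem for one field -/

section Three

variable {W : Type u} [TopologicalSpace W] [T2Space W] [SecondCountableTopology W]
  [CompactSpace W] [ChartedSpace (EuclideanHalfSpace (2 + 1)) W] [IsManifold (𝓡∂ (2 + 1)) ∞ W]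
  {g : W → ℝ} {ξ : Π x : W, TangentSpace (𝓡∂ (2 + 1)) x}

/-- **Boundary diffeomorphisms permuting the trace circles of the saddles extend (one field).**
Let `B` be a basin setting on a compact `3`-manifold with boundary `W` whose saddles (critical
points other than the minimum) all have index `1` and one common value.  Every diffeomorphism
`χ` of `∂W` which, for some bijection `σ` of the saddles, carries the trace circle of every saddle
`s` onto the trace circle of `σ s`, extends to a diffeomorphism of `W`. [cite: GriffithsHB1964Handlebody, §§3–6] [cite: HirschDT1976, Ch. 8 §1 Thm. 1.3, §3 Thm. 3.3] -/
theorem BasinSetting.diffeoExtends_of_traceOf_perm [Nonempty (BoundaryManifold.boundaryData 2 W).carrier]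
    (B : BasinSetting g ξ) (hidx : ∀ s : SaddlePt 2 g, morseIndex (𝓡∂ (2 + 1)) g s.1 = 1)
    (hval : ∀ s s' : SaddlePt 2 g, g s.1 = g s'.1)
    (χ : (𝓡∂ (2 + 1)).boundary W ≃ₘ⟮𝓡 2, 𝓡 2⟯ (𝓡∂ (2 + 1)).boundary W) (σ : SaddlePt 2 g ≃ SaddlePt 2 g)
    (hχ : ∀ s y, χ y ∈ B.traceOf (σ s) ↔ y ∈ B.traceOf s) :
    (BoundaryManifold.boundaryData 2 W).DiffeoExtends χ := by
  rcases isEmpty_or_nonempty (SaddlePt 2 g) with hE | ⟨⟨s₀⟩⟩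
  · -- no saddles: every boundary point lies in the basin, and the one-field endgame applies
    refine B.diffeoExtends_of_forall_eq χ univ isClosed_univ (fun y _ => ?_) (fun y hy => (hy (mem_univ y)).elim)
    by_contra h
    obtain ⟨s, -⟩ := BasinSetting.mem_traces_iff_exists_traceOf.1 (show y ∈ B.traces from h)
    exact hE.false s
  · set P : BasinPair g ξ ξ := BasinPair.diag B with hP
    have heq : ∀ p, IsMCriticalPt (𝓡∂ (2 + 1)) g p → ∀ᶠ x in 𝓝 p, ξ x = ξ x := fun _ _ => Eventually.of_forall fun _ => rfl
    obtain ⟨Q₀⟩ := BasinPair.SaddleData.nonempty P heq (c := g s₀.1) (fun s => hval s s₀)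
      (B.sph_lt_apply_saddle s₀) (B.apply_saddle_lt s₀)
    have hsm : ∀ s : SaddlePt 2 g, ContMDiffAt (𝓡∂ (2 + 1)) 𝓘(ℝ, ℝ) 2 g s.1 := fun s =>
      B.isMorseFunction.isMorse.contMDiff.contMDiffAt.of_le (by norm_cast)
    have hkA : ∀ s, (Q₀.DA s).k = 1 := fun s => by
      have h := (isMCriticalPt_and_morseIndex_eq_of_eq_milnorQuadratic (hsm s) (Q₀.DA s).mem_maximalAtlas
        (Q₀.DA s).mem_source (B.isInteriorPoint_saddle s) (Q₀.DA s).apply_eq).2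
      rw [hidx s] at h
      omega
    have hkB : ∀ s, (Q₀.DB s).k = 1 := fun s => by
      have h := (isMCriticalPt_and_morseIndex_eq_of_eq_milnorQuadratic (hsm s) (Q₀.DB s).mem_maximalAtlas
        (Q₀.DB s).mem_source (B.isInteriorPoint_saddle s) (Q₀.DB s).apply_eq).2
      rw [hidx s] at h
      omega
    set Q : P.SaddleData := Q₀.withPerm σ (fun s => by rw [hkA, hkB]) with hQ
    exact Q.diffeoExtends_of_traceOf hkA χ hχ

/-- **Boundary diffeomorphisms permuting the co-core circles extend — raw form** (dimension `3`).
Let `W` be a compact `3`-manifold with boundary, `g` a Morse function on `(W; ∅, ∂W)` with a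
smooth gradient-like field `ξ`, a unique critical point `p₀` of index `0`, all other critical
points of index `1` and of one common value (e.g. the Morse data of a genus-`g` handlebody).  If a
diffeomorphism `χ` of `∂W` carries, for a bijection `σ` of the remaining critical points, the
boundary points on trajectories coming from `s` onto the boundary points on trajectories coming
from `σ s` (for every `s`), then `χ` extends to a diffeomorphism of `W`. [cite: GriffithsHB1964Handlebody, §§3–6] [cite: MilnorHCobordism1965, Def. 3.9, Thm. 4.1] [cite: HirschDT1976, Ch. 8 §1 Thm. 1.3, §3 Thm. 3.3] -/
theorem Cobordism.IsMorseFunction.diffeoExtends_of_unstableSet_perm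
    {g : W → ℝ} (hg : (Cobordism.ofBoundary 2 W).IsMorseFunction g)
    {ξ : Π x : W, TangentSpace (𝓡∂ (2 + 1)) x}
    (hξs : ContMDiff (𝓡∂ (2 + 1)) (𝓡∂ (2 + 1)).tangent ∞ fun x => (⟨x, ξ x⟩ : TangentBundle (𝓡∂ (2 + 1)) W))
    (hξ : IsGradientLike (𝓡∂ (2 + 1)) g ξ) {p₀ : W} (hp₀ : criticalSetOfIndex (𝓡∂ (2 + 1)) g 0 = {p₀})
    (hidx : ∀ q, IsMCriticalPt (𝓡∂ (2 + 1)) g q → q ≠ p₀ → morseIndex (𝓡∂ (2 + 1)) g q = 1)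
    (hval : ∀ q q', IsMCriticalPt (𝓡∂ (2 + 1)) g q → IsMCriticalPt (𝓡∂ (2 + 1)) g q' → q ≠ p₀ → q' ≠ p₀ → g q = g q')
    (χ : (𝓡∂ (2 + 1)).boundary W ≃ₘ⟮𝓡 2, 𝓡 2⟯ (𝓡∂ (2 + 1)).boundary W) (σ : SaddlePt 2 g ≃ SaddlePt 2 g)
    (hχ : ∀ (s : SaddlePt 2 g) (y : (𝓡∂ (2 + 1)).boundary W),
      ((χ y : (𝓡∂ (2 + 1)).boundary W) : W) ∈ unstableSet (𝓡∂ (2 + 1)) ξ (σ s).1 ↔ (y : W) ∈ unstableSet (𝓡∂ (2 + 1)) ξ s.1) :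
    (BoundaryManifold.boundaryData 2 W).DiffeoExtends χ := by
  rcases isEmpty_or_nonempty ((𝓡∂ (2 + 1)).boundary W) with hE | hne
  · exact ⟨Diffeomorph.refl (𝓡∂ (2 + 1)) W ∞, funext fun y => (hE.false y).elim⟩
  haveI : Nonempty (BoundaryManifold.boundaryData 2 W).carrier := hne
  obtain ⟨B⟩ := BasinSetting.nonempty hg hξs hξ hp₀
  have hpp : B.p₀ = p₀ := by
    have h := B.p₀_mem_criticalSetOfIndex
    rw [hp₀] at h
    exact h
  refine B.diffeoExtends_of_traceOf_perm (fun s => hidx s.1 s.2.1 (hpp ▸ B.coe_ne_p₀ s))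
    (fun s s' => hval s.1 s'.1 s.2.1 s'.2.1 (hpp ▸ B.coe_ne_p₀ s) (hpp ▸ B.coe_ne_p₀ s')) χ σ fun s y => ?_
  rw [BasinSetting.mem_traceOf_iff, BasinSetting.mem_traceOf_iff]
  exact hχ s y

end Three

end Literature.Topology.FourManifolds
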